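import Literature.Probability.RandomPlanarGeometry.SAWTurnDensityWindow
import Literature.Probability.RandomPlanarGeometry.SAWPatternFiniteMemory16AllTurn
import Literature.Probability.RandomPlanarGeometry.SAWBendingEnergyEndpoint
import Literature.Probability.RandomPlanarGeometry.SAWAllTurnLowerBound
import HarnessLib

/-!
# `μ_AT ≤ 1.59512`: all-turn self-avoiding walks on `ℤ²` through the turn-tilted memory-16 certificate,
# and the sharp window `3/2 ≤ μ_AT ≤ 1.59512`

Topic `Literature/Probability/RandomPlanarGeometry` (continues `SAWTurnDensityWindow.lean`, the
evaluation `SAWPatternFiniteMemory16AllTurn.lean`, and the lane's «STIFF-∞» files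
`SAWBendingEnergyEndpoint.lean` — `Zd.allTurnCount`, `Zd.logMuAT` — and `SAWAllTurnLowerBound.lean` —
`Zd.muATLower_three_halves : log(3/2) ≤ logMuAT`). With letter weights `(10⁵, 1)` on (turn, straight)
the certificate `checkPC_16_allturn` gives `Σ_{w ∈ sawWords n} (10⁵)^{#turns(w)} ≤ 2⁴¹·159512ⁿ` (ratio
`159512000/1000`); an ALL-TURN word weighs `10^{5(n-1)}`, so the number `a(n) = Zd.allTurnCount n` of
`n`-step self-avoiding walks on `ℤ²` all of whose internal vertices are turns obeys
**`allTurnCount_le_pow : a(n) ≤ 2⁴¹ · 10⁵ · 1.59512ⁿ`**, hence (the infimum is below every term)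
**`logMuAT_le_log : log μ_AT ≤ log 1.59512`** and, with a-p3's Kraft lower bound,
**`muAT_window_sharp : log(3/2) ≤ log μ_AT ≤ log(159512/10⁵)`** — the all-turn (= `L`-lattice)
connective constant lies in `[1.5, 1.59512]` (elementary window `[√2, φ] = [1.414, 1.618]`,
`SAWBendingEnergyAllTurnWindow.lean`; series value `1.5657`). Memory 18 gives the same digits as 16 (all-turn
loops have length `≡ 0 (mod 4)`). Computational lineage: `Lean.ofReduceBool` through the certificate.

## References

* A. Pönitz, P. Tittmann, *Improved upper bounds for self-avoiding walks in ℤᵈ*, Electron. J.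
  Combin. 7 (2000) R21, §3 [PonitzTittmann2000].
* N. Madras, G. Slade, *The Self-Avoiding Walk* (1993), §1.2, §7.2 [MadrasSlade1993].
-/

noncomputable section

open Finset Filter Topology Literature.Probability.LatticeModels
open scoped BigOperators

namespace Literature.Probability.RandomPlanarGeometry.SAW

namespace Zd

/-- **All-turn self-avoiding walks grow at most like `1.59512ⁿ`** (`ℤ²`, every `n`):
`a(n) ≤ 2⁴¹ · 10⁵ · (159512/10⁵)ⁿ`, from the turn-tilted memory-16 certificate with weights `(10⁵, 1)`
(an all-turn word weighs `10^{5(n-1)}` in `Σ_w (10⁵)^{#turns(w)} ≤ 2⁴¹·159512ⁿ`).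
[cite: PonitzTittmann2000, §3; MadrasSlade1993, §7.2] -/
theorem allTurnCount_le_pow (n : ℕ) :
    (allTurnCount n : ℝ) ≤ 2 ^ 41 * 10 ^ 5 * ((159512 : ℝ) / 100000) ^ n := by
  classical
  unfold allTurnCount
  have hcert := FiniteMemory.sum_sawWords_patW_mul_pow_le_of_checkPC FiniteMemory.checkPC_16_allturn n
  -- the all-turn words each weigh `10^{5(n-1)}`
  set A := (sawWords n).filter fun w => FiniteMemory.patCount 0 w = n - 1 with hA
  have hcard : ((Zd.saws 2 n).filter fun ω => turns n ω = n - 1).card = A.card :=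
    FiniteMemory.card_saws_filter_turns_eq n (fun c => c = n - 1)
  have hlow : A.card * 100000 ^ (n - 1) ≤
      ∑ w ∈ sawWords n, 100000 ^ FiniteMemory.patCount 0 w * 1 ^ (n - FiniteMemory.patCount 0 w) := by
    calc A.card * 100000 ^ (n - 1) = ∑ _w ∈ A, 100000 ^ (n - 1) := by rw [sum_const, smul_eq_mul]
      _ = ∑ w ∈ A, 100000 ^ FiniteMemory.patCount 0 w * 1 ^ (n - FiniteMemory.patCount 0 w) :=
          sum_congr rfl fun w hw => by rw [hA, mem_filter] at hw; rw [hw.2, one_pow, mul_one]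
      _ ≤ _ := sum_le_sum_of_subset_of_nonneg (filter_subset _ _) fun _ _ _ => Nat.zero_le _
  have key : A.card * 100000 ^ (n - 1) * 1000 ^ n ≤ 159512000 ^ n * 2 ^ 41 :=
    le_trans (Nat.mul_le_mul_right _ hlow) hcert
  have keyR : (A.card : ℝ) * (100000 : ℝ) ^ (n - 1) * (1000 : ℝ) ^ n ≤ (159512000 : ℝ) ^ n * 2 ^ 41 := by
    exact_mod_cast key
  rw [hcard]
  rcases Nat.eq_zero_or_pos n with rfl | hn
  · norm_num at keyR ⊢
    linarith
  · obtain ⟨k, rfl⟩ := Nat.exists_eq_add_of_le hn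
    rw [show 1 + k - 1 = k by omega] at keyR
    have e : (159512000 : ℝ) ^ (1 + k) =
        (1000 : ℝ) ^ (1 + k) * ((100000 : ℝ) ^ k * 100000) * ((159512 : ℝ) / 100000) ^ (1 + k) := by
      rw [show (100000 : ℝ) ^ k * 100000 = (100000 : ℝ) ^ (1 + k) by ring, ← mul_pow, ← mul_pow]
      norm_num
    have hpos : (0 : ℝ) < (100000 : ℝ) ^ k * (1000 : ℝ) ^ (1 + k) := by positivity
    have h2 : (A.card : ℝ) * ((100000 : ℝ) ^ k * (1000 : ℝ) ^ (1 + k)) ≤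
        (2 ^ 41 * 10 ^ 5 * ((159512 : ℝ) / 100000) ^ (1 + k)) * ((100000 : ℝ) ^ k * (1000 : ℝ) ^ (1 + k)) :=
      calc (A.card : ℝ) * ((100000 : ℝ) ^ k * (1000 : ℝ) ^ (1 + k))
          = (A.card : ℝ) * (100000 : ℝ) ^ k * (1000 : ℝ) ^ (1 + k) := by ring
        _ ≤ (159512000 : ℝ) ^ (1 + k) * 2 ^ 41 := keyR
        _ = _ := by rw [e]; ring
    exact le_of_mul_le_mul_right h2 hpos

/-- **The all-turn growth constant is at most `1.59512`**: `log μ_AT ≤ log(159512/10⁵)` (`logMuAT` is an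
infimum, hence below every term `log a(N+1)/(N+1) ≤ log(2⁴¹·10⁵)/(N+1) + log 1.59512`).
[cite: PonitzTittmann2000, §3; MadrasSlade1993, §1.2] -/
theorem logMuAT_le_log : logMuAT ≤ Real.log ((159512 : ℝ) / 100000) := by
  set C : ℝ := 2 ^ 41 * 10 ^ 5 with hC
  set Λ : ℝ := (159512 : ℝ) / 100000 with hΛ
  have hC1 : 1 ≤ C := by rw [hC]; norm_num
  have hΛ1 : 1 < Λ := by rw [hΛ]; norm_num
  have hlogC : 0 ≤ Real.log C := Real.log_nonneg hC1
  have hlogΛ : 0 < Real.log Λ := Real.log_pos hΛ1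
  -- each term is at most `log Λ + log C/(N+1)`
  have hterm : ∀ N : ℕ, Real.log (allTurnCount (N + 1)) / ((N : ℝ) + 1) ≤
      Real.log Λ + Real.log C / ((N : ℝ) + 1) := by
    intro N
    have hN : (0 : ℝ) < (N : ℝ) + 1 := by positivity
    have hle := allTurnCount_le_pow (N + 1)
    have hapos : (0 : ℝ) < (allTurnCount (N + 1) : ℝ) := by exact_mod_cast one_le_allTurnCount (N + 1)
    rw [div_le_iff₀ hN, add_mul, div_mul_cancel₀ _ hN.ne']
    calc Real.log (allTurnCount (N + 1) : ℝ) ≤ Real.log (C * Λ ^ (N + 1)) :=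
          Real.log_le_log hapos (by rw [hC, hΛ]; exact hle)
      _ = Real.log Λ * ((N : ℝ) + 1) + Real.log C := by
          rw [Real.log_mul (by positivity) (by positivity), Real.log_pow]; push_cast; ring
  have key : ∀ N : ℕ, logMuAT ≤ Real.log Λ + Real.log C / ((N : ℝ) + 1) :=
    fun N => (logMuAT_le N).trans (hterm N)
  by_contra hlt
  rw [not_le] at hlt
  have hε0 : 0 < logMuAT - Real.log Λ := by linarith
  obtain ⟨N, hN⟩ := exists_nat_gt (Real.log C / (logMuAT - Real.log Λ))
  have hN1 : (0 : ℝ) < (N : ℝ) + 1 := by positivity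
  have hsmall : Real.log C / ((N : ℝ) + 1) < logMuAT - Real.log Λ := by
    rw [div_lt_iff₀ hN1]
    rw [div_lt_iff₀ hε0] at hN
    nlinarith
  have := key N
  linarith

/-- **The sharp all-turn window: `log(3/2) ≤ log μ_AT ≤ log(159512/10⁵)`**, i.e. the connective
constant of the `L`-lattice lies in `[1.5, 1.59512]` (lower half: the Kesten–Kraft bound of
`SAWAllTurnLowerBound.lean`; upper half: the memory-16 certificate). [cite: PonitzTittmann2000, §3; Kesten1963SAW, §4] -/
theorem muAT_window_sharp :
    Real.log ((3 : ℝ) / 2) ≤ logMuAT ∧ logMuAT ≤ Real.log ((159512 : ℝ) / 100000) :=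
  ⟨muATLower_three_halves, logMuAT_le_log⟩

end Zd

end Literature.Probability.RandomPlanarGeometry.SAW

end
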